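import Literature.NumberTheory.GaloisRepresentations.NeukirchAbstractContainment
import Literature.NumberTheory.GaloisRepresentations.NeukirchAxiomsOpenSubgroupRat
import Literature.NumberTheory.GaloisRepresentations.NeukirchNFBinders
import Literature.GroupTheory.LocallyConstantCochainTransportSubgroup
import Mathlib.RingTheory.RootsOfUnity.AlgebraicallyClosed
import HarnessLib

/-!
# [NSW] (12.1.9) over `ℚ`: a subgroup of `Gal(\bar ℚ/ℚ)` of local type lies in a decomposition group

Topic `NumberTheory/GaloisRepresentations`; namespace
`Literature.NumberTheory.GaloisRepresentations.ExplicitMuCocycles`.  Proof file: theorems only (no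
definition, no instance, no named fact).  Classical algebraic number theory (abc-iut GAP-LEDGER row
G-L4d2g4-1, campaign L): the containment lemma of Neukirch's theorem ([NeukirchSchmidtWingberg2008]
Prop. (12.1.9); [Neukirch1969] Satz 2) in the form consumed by the Neukirch–Uchida sub-DAG
(row R1, `NeukirchUchidaProof.existsUnique_map_stabilizer_subgroupOf_eq_of_isOpen`, hypotheses `hα`,
`hα'`) over the base field `ℚ`:

* `exists_map_stabilizer_subgroupOf_le` — for open subgroups `U₁, U₂ ≤ Γ = Gal(Ω/ℚ)`, an isomorphism of
  topological groups `α : U₁ ≃ₜ* U₂` and a nonarchimedean prime `A` of `Ω` (valuation subring `≠ ⊤`),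
  the image `α(D_A ∩ U₁)` lies in a decomposition group `D_B`, `B ≠ ⊤`;
* `exists_map_symm_stabilizer_subgroupOf_le` — the same for `α⁻¹` (the `hα'` shape).

PROOF: the abstract lemma `NeukirchAbstract.exists_prime_smul_eq_of_localType` (explicit locally
constant `ℤ/3`-cochains on the profinite `Γ`, `Γ`-set `P =` nonarchimedean primes of `Ω`,
`V₀ = Stab_Γ(ζ₃)`) with its hypotheses supplied by the tree: structural binders and the D-side local
axioms (AxLn/AxD/AxLv/AxLi) from `NeukirchNFBinders` (abc-iut-w6-d070: local Tate duality
`H²(G_k, ℤ/ℓ) ≅ ℤ/ℓ` for `μ_ℓ ⊂ k`, restriction/corestriction), the global axioms (AxH/AxF/AxG) from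
`NeukirchAxiomsOpenSubgroupRat` (Hasse principle for `Br`, finite support, two-place separation, base
change to `K_V`), and the local-type hypotheses (AxL1/AxL2) for `H'' = α(D_A ∩ U₁')` by transport along
`α` (`LocallyConstantCochainTransportSubgroup`).  The normaliser form of the abstract conclusion gives
`α(D_A ∩ U₁) ≤ D_B` although only `H'' ≤ V₀`.

HONEST FRAMING: classical; nothing here bears on [IUTchIII] Cor. 3.12; no side taken.

## References

* J. Neukirch, A. Schmidt, K. Wingberg, *Cohomology of Number Fields* (2nd ed. 2008), XII §1
  Prop. (12.1.9), §2 Thm. (12.2.1). [NeukirchSchmidtWingberg2008]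
* J. Neukirch, *Kennzeichnung der p-adischen und der endlichen algebraischen Zahlkörper*,
  Invent. Math. 6 (1969) 296–314, Satz 2. [Neukirch1969]
-/

noncomputable section

open Function Field IsDedekindDomain NumberField Topology
open scoped Pointwise

namespace Literature.NumberTheory.GaloisRepresentations.ExplicitMuCocycles

open Literature.NumberTheory.GaloisRepresentations Literature.AnabelianGeometry.AbsoluteAnabelian
open Literature.GroupTheory.LocallyConstantCocycles

/-! ### Images and preimages of subgroups of `Γ` under `α : U₁ ≃ₜ* U₂` -/

section Alpha

variable {Γ : Type*} [Group Γ] [TopologicalSpace Γ]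
variable {U₁ U₂ : Subgroup Γ} (α : U₁ ≃ₜ* U₂)

/-- Membership in the image `α(S) := ((S ∩ U₁).map α).map U₂.subtype ≤ Γ`.
[cite: NeukirchSchmidtWingberg2008, XII §2 (12.2.1)] -/
private theorem mem_img_iff (S : Subgroup Γ) (y : Γ) :
    y ∈ ((S.subgroupOf U₁).map α.toMonoidHom).map U₂.subtype ↔
      ∃ x : U₁, (x : Γ) ∈ S ∧ ((α x : U₂) : Γ) = y := by
  constructor
  · rintro ⟨z, ⟨x, hx, rfl⟩, rfl⟩
    exact ⟨x, Subgroup.mem_subgroupOf.mp hx, rfl⟩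
  · rintro ⟨x, hx, rfl⟩
    exact ⟨α x, ⟨x, Subgroup.mem_subgroupOf.mpr hx, rfl⟩, rfl⟩

/-- Membership in the preimage `α⁻¹(T) := ((T ∩ U₂).comap α).map U₁.subtype ≤ Γ`.
[cite: NeukirchSchmidtWingberg2008, XII §2 (12.2.1)] -/
private theorem mem_pre_iff (T : Subgroup Γ) (x : Γ) :
    x ∈ ((T.subgroupOf U₂).comap α.toMonoidHom).map U₁.subtype ↔
      ∃ hx : x ∈ U₁, ((α ⟨x, hx⟩ : U₂) : Γ) ∈ T := by
  constructor
  · rintro ⟨x', hx', rfl⟩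
    exact ⟨x'.2, Subgroup.mem_subgroupOf.mp hx'⟩
  · rintro ⟨hx, hT⟩
    exact ⟨⟨x, hx⟩, Subgroup.mem_subgroupOf.mpr hT, rfl⟩

/-- `α⁻¹(T)` is open for `T` open (`U₁` open). [cite: NeukirchSchmidtWingberg2008, XII §2 (12.2.1)] -/
private theorem isOpen_pre (hU₁ : IsOpen (U₁ : Set Γ)) (T : Subgroup Γ) (hT : IsOpen (T : Set Γ)) :
    IsOpen ((((T.subgroupOf U₂).comap α.toMonoidHom).map U₁.subtype : Subgroup Γ) : Set Γ) := by
  have h1 : IsOpen (((T.subgroupOf U₂).comap α.toMonoidHom : Subgroup U₁) : Set U₁) := by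
    have : (((T.subgroupOf U₂).comap α.toMonoidHom : Subgroup U₁) : Set U₁) =
        (fun x : U₁ => ((α x : U₂) : Γ)) ⁻¹' (T : Set Γ) := by
      ext x; rfl
    rw [this]
    exact hT.preimage (continuous_subtype_val.comp α.continuous)
  have h2 : ((((T.subgroupOf U₂).comap α.toMonoidHom).map U₁.subtype : Subgroup Γ) : Set Γ) =
      Subtype.val '' (((T.subgroupOf U₂).comap α.toMonoidHom : Subgroup U₁) : Set U₁) :=
    Subgroup.coe_map _ _
  rw [h2]
  exact hU₁.isOpenMap_subtype_val _ h1

/-- `α(S)` is closed for `S` closed (`U₁` open, `Γ` compact Hausdorff).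
[cite: NeukirchSchmidtWingberg2008, XII §2 (12.2.1)] -/
private theorem isClosed_img [IsTopologicalGroup Γ] [CompactSpace Γ] [T2Space Γ]
    (hU₁ : IsOpen (U₁ : Set Γ)) (S : Subgroup Γ) (hS : IsClosed (S : Set Γ)) :
    IsClosed ((((S.subgroupOf U₁).map α.toMonoidHom).map U₂.subtype : Subgroup Γ) : Set Γ) := by
  haveI : CompactSpace U₁ := isCompact_iff_compactSpace.mp (U₁.isClosed_of_isOpen hU₁).isCompact
  have h1 : IsClosed (((S.subgroupOf U₁) : Subgroup U₁) : Set U₁) :=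
    hS.preimage continuous_subtype_val
  have h2 : ((((S.subgroupOf U₁).map α.toMonoidHom).map U₂.subtype : Subgroup Γ) : Set Γ) =
      (fun x : U₁ => ((α x : U₂) : Γ)) '' (((S.subgroupOf U₁) : Subgroup U₁) : Set U₁) := by
    rw [Subgroup.coe_map, Subgroup.coe_map, Set.image_image]; rfl
  rw [h2]
  exact (h1.isCompact.image (continuous_subtype_val.comp α.continuous)).isClosed

/-- `α(S) ∩ T = α(S ∩ α⁻¹(T))`. [cite: NeukirchSchmidtWingberg2008, XII §2 (12.2.1)] -/
private theorem img_inf_eq (S T : Subgroup Γ) :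
    ((S.subgroupOf U₁).map α.toMonoidHom).map U₂.subtype ⊓ T =
      (((S ⊓ ((T.subgroupOf U₂).comap α.toMonoidHom).map U₁.subtype).subgroupOf U₁).map
        α.toMonoidHom).map U₂.subtype := by
  ext y
  rw [Subgroup.mem_inf, mem_img_iff, mem_img_iff]
  constructor
  · rintro ⟨⟨x, hxS, rfl⟩, hyT⟩
    refine ⟨x, Subgroup.mem_inf.mpr ⟨hxS, (mem_pre_iff α T x).mpr ⟨x.2, ?_⟩⟩, rfl⟩
    simpa using hyT
  · rintro ⟨x, hx, rfl⟩
    obtain ⟨hxS, hxT⟩ := Subgroup.mem_inf.mp hx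
    obtain ⟨hx', hT⟩ := (mem_pre_iff α T x).mp hxT
    refine ⟨⟨x, hxS, rfl⟩, ?_⟩
    simpa using hT

/-- Conjugating `α(S)` by `α(u)` is `α(u S u⁻¹)` for `u ∈ U₁`, `S ≤ U₁`.
[cite: NeukirchSchmidtWingberg2008, XII §2 (12.2.1)] -/
private theorem img_map_conj (S : Subgroup Γ) (hS : S ≤ U₁) (u : U₁) :
    (((S.subgroupOf U₁).map α.toMonoidHom).map U₂.subtype).map
        (MulAut.conj ((α u : U₂) : Γ)).toMonoidHom =
      (((S.map (MulAut.conj (u : Γ)).toMonoidHom).subgroupOf U₁).map α.toMonoidHom).map U₂.subtype := by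
  ext y
  rw [Subgroup.mem_map, mem_img_iff]
  constructor
  · rintro ⟨y', hy', rfl⟩
    obtain ⟨x, hxS, rfl⟩ := (mem_img_iff α S y').mp hy'
    refine ⟨u * x * u⁻¹, ?_, ?_⟩
    · rw [Subgroup.mem_map]
      exact ⟨x, hxS, by simp [MulAut.conj_apply]⟩
    · simp only [map_mul, map_inv, Subgroup.coe_mul, Subgroup.coe_inv, MulEquiv.coe_toMonoidHom,
        MulAut.conj_apply]
  · rintro ⟨x, hx, rfl⟩
    obtain ⟨s, hs, hsx⟩ := Subgroup.mem_map.mp hx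
    have hsU : s ∈ U₁ := hS hs
    refine ⟨((α ⟨s, hsU⟩ : U₂) : Γ), (mem_img_iff α S _).mpr ⟨⟨s, hsU⟩, hs, rfl⟩, ?_⟩
    have hx' : x = u * ⟨s, hsU⟩ * u⁻¹ := by
      apply Subtype.ext
      simp only [Subgroup.coe_mul, Subgroup.coe_inv, ← hsx, MulEquiv.coe_toMonoidHom, MulAut.conj_apply]
    rw [hx']
    simp only [map_mul, map_inv, Subgroup.coe_mul, Subgroup.coe_inv, MulEquiv.coe_toMonoidHom,
      MulAut.conj_apply]

end Alpha

/-! ### The containment lemma over `ℚ` -/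

/-- **[NSW] Prop. (12.1.9) over `ℚ`, containment form** (row R1 hypothesis `hα` of the
Neukirch–Uchida sub-DAG).  Let `U₁, U₂ ≤ Γ = Gal(Ω/ℚ)` be subgroups with `U₁` open, `α : U₁ ≃ₜ* U₂` an
isomorphism of topological groups and `A` a nonarchimedean prime of `Ω` (a valuation subring `≠ ⊤`).
Then `α(D_A ∩ U₁) ≤ D_B` for some nonarchimedean prime `B` of `Ω`: a closed subgroup of `Γ` of local
type (here `α(D_A ∩ U₁)`, isomorphic to an open subgroup of `D_A ≅ Gal(\bar ℚ_p/ℚ_p)`) lies in a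
decomposition group. [cite: NeukirchSchmidtWingberg2008, XII §1 Prop. (12.1.9)] -/
theorem exists_map_stabilizer_subgroupOf_le {U₁ U₂ : Subgroup (absoluteGaloisGroup ℚ)}
    (hU₁ : IsOpen (U₁ : Set (absoluteGaloisGroup ℚ)))
    (α : U₁ ≃ₜ* U₂) (A : ValuationSubring (AlgebraicClosure ℚ)) (hA : A ≠ ⊤) :
    ∃ B : ValuationSubring (AlgebraicClosure ℚ), B ≠ ⊤ ∧
      ((MulAction.stabilizer (absoluteGaloisGroup ℚ) A).subgroupOf U₁).map α.toMulEquiv.toMonoidHom ≤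
        (MulAction.stabilizer (absoluteGaloisGroup ℚ) B).subgroupOf U₂ := by
  classical
  letI : MulAction (absoluteGaloisGroup ℚ) (NumberFieldValuationProSet.NonArch ℚ) :=
    NumberFieldValuationProSet.nonArchAction ℚ
  have hstab : ∀ p : NumberFieldValuationProSet.NonArch ℚ,
      MulAction.stabilizer (absoluteGaloisGroup ℚ) p = MulAction.stabilizer (absoluteGaloisGroup ℚ) p.1 := by
    intro p
    ext g
    simp only [MulAction.mem_stabilizer_iff, Subtype.ext_iff]
    rfl
  haveI h3 : Fact (Nat.Prime 3) := ⟨Nat.prime_three⟩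
  obtain ⟨ζ, hζ⟩ : ∃ ζ : AlgebraicClosure ℚ, IsPrimitiveRoot ζ 3 := HasEnoughRootsOfUnity.prim
  set V₀ : Subgroup (absoluteGaloisGroup ℚ) := MulAction.stabilizer (absoluteGaloisGroup ℚ) ζ with hV₀def
  have hV₀ : IsOpen (V₀ : Set (absoluteGaloisGroup ℚ)) := isOpen_stabilizer_root ℚ ζ
  haveI hV₀n : V₀.Normal := stabilizer_primitiveRoot_normal ℚ Nat.prime_three hζ
  have hVζ : ∀ {V : Subgroup (absoluteGaloisGroup ℚ)}, V ≤ V₀ → ∀ g ∈ V, g • ζ = ζ := fun hV g hg =>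
    MulAction.mem_stabilizer_iff.mp (hV hg)
  -- images and preimages under `α`
  let img : Subgroup (absoluteGaloisGroup ℚ) → Subgroup (absoluteGaloisGroup ℚ) := fun S => ((S.subgroupOf U₁).map α.toMonoidHom).map U₂.subtype
  let pre : Subgroup (absoluteGaloisGroup ℚ) → Subgroup (absoluteGaloisGroup ℚ) := fun T => ((T.subgroupOf U₂).comap α.toMonoidHom).map U₁.subtype
  have hpre_le : ∀ T, pre T ≤ U₁ := fun T x hx => ((mem_pre_iff α T x).mp hx).1
  have himg_le : ∀ S T, S ≤ pre T → img S ≤ T := by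
    intro S T hST y hy
    obtain ⟨x, hxS, rfl⟩ := (mem_img_iff α S y).mp hy
    obtain ⟨hx, hT⟩ := (mem_pre_iff α T x).mp (hST hxS)
    simpa using hT
  -- the source-side open normal subgroup `U₁' = U₁ ∩ V₀ ∩ α⁻¹(V₀)` and `H'' = α(D_A ∩ U₁')`
  set U₁' : Subgroup (absoluteGaloisGroup ℚ) := U₁ ⊓ V₀ ⊓ pre V₀ with hU₁'def
  have hU₁'open : IsOpen (U₁' : Set (absoluteGaloisGroup ℚ)) := (hU₁.inter hV₀).inter (isOpen_pre α hU₁ V₀ hV₀)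
  have hU₁'U₁ : U₁' ≤ U₁ := fun x hx => hx.1.1
  have hU₁'V₀ : U₁' ≤ V₀ := fun x hx => hx.1.2
  set D : Subgroup (absoluteGaloisGroup ℚ) := MulAction.stabilizer (absoluteGaloisGroup ℚ) A with hDdef
  have hDclosed : IsClosed (D : Set (absoluteGaloisGroup ℚ)) := isClosed_stabilizer_valuationSubring ℚ A
  set H'' : Subgroup (absoluteGaloisGroup ℚ) := img (D ⊓ U₁') with hH''def
  have hH''V₀ : H'' ≤ V₀ := himg_le _ _ fun x hx => hx.2.2
  have hH''closed : IsClosed (H'' : Set (absoluteGaloisGroup ℚ)) :=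
    isClosed_img α hU₁ _ (hDclosed.inter (U₁'.isClosed_of_isOpen hU₁'open))
  -- the pieces `H'' ∩ N = α(D_A ∩ W_N)`, `W_N = U₁' ∩ α⁻¹(N)` open `≤ V₀`
  have hWN : ∀ N : OpenNormalSubgroup (absoluteGaloisGroup ℚ),
      IsOpen ((U₁' ⊓ pre N : Subgroup (absoluteGaloisGroup ℚ)) : Set (absoluteGaloisGroup ℚ)) ∧ U₁' ⊓ pre N ≤ V₀ ∧ D ⊓ (U₁' ⊓ pre N) ≤ U₁ ∧
        H'' ⊓ (N : Subgroup (absoluteGaloisGroup ℚ)) = img (D ⊓ (U₁' ⊓ pre N)) := by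
    intro N
    refine ⟨hU₁'open.inter (isOpen_pre α hU₁ N N.isOpen), fun x hx => hU₁'V₀ hx.1,
      fun x hx => hU₁'U₁ hx.2.1, ?_⟩
    rw [hH''def, img_inf_eq α (D ⊓ U₁') N, inf_assoc]
  -- the abstract lemma
  obtain ⟨p, hp⟩ := NeukirchAbstract.exists_prime_smul_eq_of_localType
    (Γ := absoluteGaloisGroup ℚ) (R := ZMod 3) (P := NumberFieldValuationProSet.NonArch ℚ)
    (fun (S : Subgroup (absoluteGaloisGroup ℚ)) (f : (absoluteGaloisGroup ℚ) → (absoluteGaloisGroup ℚ) → ZMod 3) => ∃ β : (absoluteGaloisGroup ℚ) → ZMod 3,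
      IsLocallyConstant (fun s : S => β s) ∧ ∀ a ∈ S, ∀ b ∈ S, f a b = β a + β b - β (a * b))
    (fun _ _ => Iff.rfl) Nat.prime_three
    (fun p => by rw [hstab]; exact isClosed_stabilizer_valuationSubring ℚ p.1)
    (fun p : NumberFieldValuationProSet.NonArch ℚ => (absIntegersCentre p.1).under (𝓞 ℚ))
    (fun i => by
      obtain ⟨s, hs⟩ := finite_orbits_fibre ℚ i
      exact ⟨s, fun p hp => by
        obtain ⟨q, hq, g, hg⟩ := hs p hp
        exact ⟨q, hq, g, Subtype.ext hg⟩⟩)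
    hV₀
    (fun V hV hVV₀ f hlc hcoc hall =>
      coboundaryOn_of_forall_coboundaryOn_stabilizer_inf V hV Nat.prime_three (by decide) hζ (hVζ hVV₀)
        f hlc hcoc fun B hB => by have h := hall ⟨B, hB⟩; rw [hstab] at h; exact h)
    (fun V hV hVV₀ f hlc hcoc => by
      refine ((finite_setOf_exists_not_coboundaryOn_stabilizer_inf V hV Nat.prime_three f hlc hcoc).image
        (fun v : HeightOneSpectrum (𝓞 ℚ) => v.asIdeal)).subset ?_
      rintro i ⟨p, rfl, hbad⟩
      obtain ⟨v, 𝔓, h𝔓v, hdic⟩ := exists_ideal_mem_primesAbove_of_ne_top p.1 p.2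
      have hcentre : absIntegersCentre p.1 = 𝔓 := by
        ext s; rw [mem_absIntegersCentre_iff, hdic]
      haveI := h𝔓v.2
      rw [hstab] at hbad
      refine ⟨v, ⟨p.1, p.2, ⟨𝔓, h𝔓v, hdic⟩, hbad⟩, ?_⟩
      change v.asIdeal = (absIntegersCentre p.1).under (𝓞 ℚ)
      rw [hcentre]
      exact Ideal.LiesOver.over)
    (fun V hV hVV₀ p f g hflc hfcoc hglc hgcoc hf => by
      rw [hstab] at hflc hfcoc hglc hgcoc hf ⊢
      exact axD_of_le_stabilizer hζ p.1 p.2 V hV hVV₀ f g hflc hfcoc hglc hgcoc hf)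
    (fun V hV hVV₀ p₁ p₂ hne => by
      rw [hstab p₁, hstab p₂]
      exact exists_cocycleOn_not_coboundaryOn_and_coboundaryOn_stabilizer_inf V hV Nat.prime_three hζ
        (hVζ hVV₀) p₁.2 p₂.2 fun g hg heq => hne g hg (Subtype.ext heq))
    (fun p W hW hWV₀ => by
      rw [hstab]
      exact axLn_of_le_stabilizer hζ p.1 p.2 W hW hWV₀)
    (fun p W W' hW hW' hWV₀ hW'W hdvd f hflc hfcoc => by
      rw [hstab] at hdvd hflc hfcoc ⊢
      exact axLv_of_le_stabilizer hζ p.1 p.2 W W' hW hW' hWV₀ hW'W hdvd f hflc hfcoc)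
    (fun p W W' hW hW' hWV₀ hW'W hnd f hflc hfcoc hcob => by
      rw [hstab] at hnd hflc hfcoc hcob ⊢
      exact axLi_of_le_stabilizer hζ p.1 p.2 W W' hW hW' hWV₀ hW'W hnd f hflc hfcoc hcob)
    hH''closed hH''V₀
    (fun N => by
      obtain ⟨hWo, hWV, hSU, hEq⟩ := hWN N
      obtain ⟨e, -⟩ := exists_continuousMulEquiv_subgroupOfMap U₁ U₂ α (D ⊓ (U₁' ⊓ pre N)) hSU
      rw [hEq]
      exact exists_cocycleOn_not_coboundaryOn_of_equiv _ _ e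
        (axLn_of_le_stabilizer hζ A hA _ hWo hWV))
    (fun N f g hflc hfcoc hglc hgcoc hf => by
      obtain ⟨hWo, hWV, hSU, hEq⟩ := hWN N
      obtain ⟨e, -⟩ := exists_continuousMulEquiv_subgroupOfMap U₁ U₂ α (D ⊓ (U₁' ⊓ pre N)) hSU
      rw [hEq] at hflc hfcoc hglc hgcoc hf ⊢
      obtain ⟨c, hc⟩ := sub_mul_coboundaryOn_of_equiv _ _ e
        (fun f₁ g₁ h₁ h₂ h₃ h₄ h₅ => axD_of_le_stabilizer hζ A hA _ hWo hWV f₁ g₁ h₁ h₂ h₃ h₄ h₅)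
        f g hflc hfcoc hglc hgcoc hf
      exact ⟨c, hc⟩)
  -- `p = B`; every element of `α(D_A ∩ U₁)` normalises `H''`, hence fixes `B`
  refine ⟨p.1, p.2, ?_⟩
  intro y hy
  obtain ⟨x, hx, rfl⟩ := Subgroup.mem_map.mp hy
  rw [Subgroup.mem_subgroupOf] at hx ⊢
  have hxD : (x : (absoluteGaloisGroup ℚ)) ∈ D := hx
  -- `U₁'` and `D ∩ U₁'` are normalised by `x`
  have hU₁'conj : ∀ u z : U₁, (z : absoluteGaloisGroup ℚ) ∈ U₁' →
      ((u * z * u⁻¹ : U₁) : absoluteGaloisGroup ℚ) ∈ U₁' := by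
    intro u z hz
    have hzV : (z : absoluteGaloisGroup ℚ) ∈ V₀ := hz.1.2
    -- `α⁻¹(V₀) ∩ U₁` is normal in `U₁`
    haveI hN : ((V₀.subgroupOf U₂).comap α.toMonoidHom).Normal :=
      (hV₀n.subgroupOf U₂).comap _
    have hz' : z ∈ (V₀.subgroupOf U₂).comap α.toMonoidHom := by
      obtain ⟨z₀, hz₀, hz₀z⟩ := Subgroup.mem_map.mp hz.2
      have : z₀ = z := Subtype.ext hz₀z
      exact this ▸ hz₀
    have h1 : ((u * z * u⁻¹ : U₁) : absoluteGaloisGroup ℚ) ∈ V₀ := by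
      rw [Subgroup.coe_mul, Subgroup.coe_inv]
      exact hV₀n.conj_mem _ hzV _
    exact ⟨⟨(u * z * u⁻¹).2, h1⟩, Subgroup.mem_map.mpr ⟨u * z * u⁻¹, hN.conj_mem z hz' u, rfl⟩⟩
  have key : ∀ u : U₁, (u : absoluteGaloisGroup ℚ) ∈ D → ∀ z ∈ D ⊓ U₁',
      (u : absoluteGaloisGroup ℚ) * z * (u : absoluteGaloisGroup ℚ)⁻¹ ∈ D ⊓ U₁' := by
    intro u hu z hz
    have h1 := hU₁'conj u ⟨z, hU₁'U₁ hz.2⟩ hz.2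
    rw [Subgroup.coe_mul, Subgroup.coe_inv] at h1
    exact ⟨D.mul_mem (D.mul_mem hu hz.1) (D.inv_mem hu), h1⟩
  have hconj : (D ⊓ U₁').map (MulAut.conj (x : absoluteGaloisGroup ℚ)).toMonoidHom = D ⊓ U₁' := by
    ext z
    rw [Subgroup.mem_map]
    constructor
    · rintro ⟨z', hz', rfl⟩
      exact key x hxD z' hz'
    · intro hz
      refine ⟨(x : absoluteGaloisGroup ℚ)⁻¹ * z * (x : absoluteGaloisGroup ℚ), ?_, ?_⟩
      · have := key x⁻¹ (D.inv_mem hxD) z hz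
        simpa using this
      · simp only [MulEquiv.coe_toMonoidHom, MulAut.conj_apply]
        group
  have hnorm : H''.map (MulAut.conj ((α x : U₂) : (absoluteGaloisGroup ℚ))).toMonoidHom = H'' := by
    rw [hH''def]
    rw [show img (D ⊓ U₁') = (((D ⊓ U₁').subgroupOf U₁).map α.toMonoidHom).map U₂.subtype from rfl,
      img_map_conj α (D ⊓ U₁') (fun z hz => hU₁'U₁ hz.2) x, hconj]
  have hfix := hp ((α x : U₂) : (absoluteGaloisGroup ℚ)) hnorm
  have : ((α x : U₂) : (absoluteGaloisGroup ℚ)) • p.1 = p.1 := congrArg Subtype.val hfix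
  exact MulAction.mem_stabilizer_iff.mpr this

/-- **[NSW] Prop. (12.1.9) over `ℚ` for `α⁻¹`** (row R1 hypothesis `hα'`): with `U₁, U₂, α` as in
`exists_map_stabilizer_subgroupOf_le`, for every nonarchimedean prime `B` of `Ω` the preimage
`α⁻¹(D_B ∩ U₂)` lies in a decomposition group `D_A`, `A ≠ ⊤`.
[cite: NeukirchSchmidtWingberg2008, XII §1 Prop. (12.1.9)] -/
theorem exists_map_symm_stabilizer_subgroupOf_le {U₁ U₂ : Subgroup (absoluteGaloisGroup ℚ)}
    (hU₂ : IsOpen (U₂ : Set (absoluteGaloisGroup ℚ)))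
    (α : U₁ ≃ₜ* U₂) (B : ValuationSubring (AlgebraicClosure ℚ)) (hB : B ≠ ⊤) :
    ∃ A : ValuationSubring (AlgebraicClosure ℚ), A ≠ ⊤ ∧
      ((MulAction.stabilizer (absoluteGaloisGroup ℚ) B).subgroupOf U₂).map
          α.toMulEquiv.symm.toMonoidHom ≤
        (MulAction.stabilizer (absoluteGaloisGroup ℚ) A).subgroupOf U₁ :=
  exists_map_stabilizer_subgroupOf_le hU₂ α.symm B hB

end Literature.NumberTheory.GaloisRepresentations.ExplicitMuCocycles

end
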